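import Mathlib
import Literature.Probability.Percolation.PercolationProofs
import Summits.CriticalPhenomena.PercolationContinuityZ3.Theorems.PercNearOneGluingAdditiveGluingKnThm2GoodAux
import Summits.CriticalPhenomena.PercolationContinuityZ3.Theorems.PercNearOneGluingAdditiveGluingKnThm2GoodEvents
import Summits.CriticalPhenomena.PercolationContinuityZ3.Theorems.PercNearOneGluingAdditiveGluingBhkSets
import HarnessLib

/-! # Crux `PercNearOneGluing.AdditiveGluing` (stmt-CriticalPhenomena-4576), line
`replica-splice-at-entrance` — stub `stub_knBadBound`

Helper file for the crux skeleton of the line `replica-splice-at-entrance` (lead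
prover-line-stmt-CriticalPhenomena-4576-c3-0).  Proves exactly the registered stub signature
`stub_knBadBound`; lands with `--supports stmt-CriticalPhenomena-4576`.

## Content

Kozma–Nitzan, arXiv:2401.12397, proof of **Theorem 2** (§3.2, pp. 8–9), the six
van den Berg–Häggström–Kahn bounds for three relays `A = {a₁, a₂, a₃}`, observer `o`, target `b`
on the finite weighted graph `Fin n` (`μ = prodBernoulli w`, `{x ↔ y} = openConn x y`), assembled
WITHOUT the good-case side condition and WITHOUT the `τ`-ordering (only distinctness of the
relays is used).  Notation: separation events `N₁₂ = {a₁ ↮ a₃} ∩ {a₂ ↮ a₃}`,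
`N₁ = {a₁ ↮ a₂} ∩ {a₁ ↮ a₃}`, `N₂ = {a₂ ↮ a₁} ∩ {a₂ ↮ a₃}`, `Pₖ = μ(Nₖ)`,
`A₁₂ = μ(N₁₂ ∩ ({a₁ ↔ o} ∪ {a₂ ↔ o}))`, `Aₖ = μ(Nₖ ∩ {aₖ ↔ o})`, the patterns
`m_T = μ(𝒞(b) ∩ A = T)`, and `X = μ(o ↔ A, o ↔ b) − μ(o ↔ A, a₃ ↔ b)`:

`P₁ P₂ A₁₂ (m₁₂ − m₃) + P₁₂ P₂ A₁ (m₁ − m₂₃) + P₁₂ P₁ A₂ (m₂ − m₁₃) ≤ P₁₂ P₁ P₂ X`.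

Proof: the six set-BHK bounds (`knThm2_bhkOne/Two` of the sibling file `…KnThm2GoodAux`, fed by
the landed `stub_bhkSets`, instantiated exactly as in `knThm2_core`) give
`A₁₂ m₁₂ ≤ P₁₂ T₁₂`, `P₁₂ U₁₂ ≤ A₁₂ m₃`, `A₁ m₁ ≤ P₁ T₁`, `P₁ U₁ ≤ A₁ m₂₃`, `A₂ m₂ ≤ P₂ T₂`,
`P₂ U₂ ≤ A₂ m₁₃`; hence `A₁₂ (m₁₂ − m₃) ≤ P₁₂ (T₁₂ − U₁₂)` etc.; multiply by the two other
(nonnegative) `P`'s, add, and use `X = (T₁₂ − U₁₂) + (T₁ − U₁) + (T₂ − U₂)`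
(`stub_knThm2GoodSplit` of the sibling file `…KnThm2GoodEvents`).  The patterns `m_T`, written
in the statement on the cluster of `b`, are identified with the events the BHK lemmas produce
(`knThm2_m12`, `knThm2_m3` and the four identities `knBad_m*` below).
-/

namespace Summit.CriticalPhenomena.PercolationContinuityZ3.Theorems

open MeasureTheory Set Literature.Probability.LatticeModels Literature.Probability.Percolation

noncomputable section
open Classical

variable {n : ℕ}

/-! ### The remaining patterns of `𝒞(b) ∩ A` on the separation events -/

/-- `m₁`: `{b↔a₁} ∩ {b↮a₂} ∩ {b↮a₃} = N₁ ∩ {a₁↔b}`.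
[cite: KozmaNitzan2024, §3.2 (definition of m_S, p. 8)] -/
theorem knBad_m1 (b a₁ a₂ a₃ : Fin n) :
    (openConn b a₁ ∩ (openConn b a₂)ᶜ ∩ (openConn b a₃)ᶜ : Set (BondConfig (Fin n))) =
      (openConn a₁ a₂)ᶜ ∩ (openConn a₁ a₃)ᶜ ∩ openConn a₁ b := by
  ext ω
  simp only [Set.mem_inter_iff, Set.mem_compl_iff, knThm2_mem_openConn]
  constructor
  · rintro ⟨⟨h1, h2⟩, h3⟩
    exact ⟨⟨fun h => h2 (h1.trans h), fun h => h3 (h1.trans h)⟩, h1.symm⟩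
  · rintro ⟨⟨h12, h13⟩, h1⟩
    exact ⟨⟨h1.symm, fun h => h12 (h1.trans h)⟩, fun h => h13 (h1.trans h)⟩

/-- `m₂₃`: `{b↔a₂} ∩ {b↔a₃} ∩ {b↮a₁} = N₁ ∩ ({a₂↔b} ∩ {a₃↔b})`.
[cite: KozmaNitzan2024, §3.2 (definition of m_S, p. 8)] -/
theorem knBad_m23 (b a₁ a₂ a₃ : Fin n) :
    (openConn b a₂ ∩ openConn b a₃ ∩ (openConn b a₁)ᶜ : Set (BondConfig (Fin n))) =
      (openConn a₁ a₂)ᶜ ∩ (openConn a₁ a₃)ᶜ ∩ (openConn a₂ b ∩ openConn a₃ b) := by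
  ext ω
  simp only [Set.mem_inter_iff, Set.mem_compl_iff, knThm2_mem_openConn]
  constructor
  · rintro ⟨⟨h2, h3⟩, h1⟩
    exact ⟨⟨fun h => h1 (h2.trans h.symm), fun h => h1 (h3.trans h.symm)⟩, h2.symm, h3.symm⟩
  · rintro ⟨⟨h12, -⟩, h2, h3⟩
    exact ⟨⟨h2.symm, h3.symm⟩, fun h => h12 (h.symm.trans h2.symm)⟩

/-- `m₂`: `{b↔a₂} ∩ {b↮a₁} ∩ {b↮a₃} = N₂ ∩ {a₂↔b}`.
[cite: KozmaNitzan2024, §3.2 (definition of m_S, p. 8)] -/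
theorem knBad_m2 (b a₁ a₂ a₃ : Fin n) :
    (openConn b a₂ ∩ (openConn b a₁)ᶜ ∩ (openConn b a₃)ᶜ : Set (BondConfig (Fin n))) =
      (openConn a₂ a₁)ᶜ ∩ (openConn a₂ a₃)ᶜ ∩ openConn a₂ b := by
  ext ω
  simp only [Set.mem_inter_iff, Set.mem_compl_iff, knThm2_mem_openConn]
  constructor
  · rintro ⟨⟨h2, h1⟩, h3⟩
    exact ⟨⟨fun h => h1 (h2.trans h), fun h => h3 (h2.trans h)⟩, h2.symm⟩
  · rintro ⟨⟨h21, h23⟩, h2⟩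
    exact ⟨⟨h2.symm, fun h => h21 (h2.trans h)⟩, fun h => h23 (h2.trans h)⟩

/-- `m₁₃`: `{b↔a₁} ∩ {b↔a₃} ∩ {b↮a₂} = N₂ ∩ ({a₁↔b} ∩ {a₃↔b})`.
[cite: KozmaNitzan2024, §3.2 (definition of m_S, p. 8)] -/
theorem knBad_m13 (b a₁ a₂ a₃ : Fin n) :
    (openConn b a₁ ∩ openConn b a₃ ∩ (openConn b a₂)ᶜ : Set (BondConfig (Fin n))) =
      (openConn a₂ a₁)ᶜ ∩ (openConn a₂ a₃)ᶜ ∩ (openConn a₁ b ∩ openConn a₃ b) := by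
  ext ω
  simp only [Set.mem_inter_iff, Set.mem_compl_iff, knThm2_mem_openConn]
  constructor
  · rintro ⟨⟨h1, h3⟩, h2⟩
    exact ⟨⟨fun h => h2 (h1.trans h.symm), fun h => h2 (h3.trans h.symm)⟩, h1.symm, h3.symm⟩
  · rintro ⟨⟨h21, -⟩, h1, h3⟩
    exact ⟨⟨h1.symm, h3.symm⟩, fun h => h21 (h.symm.trans h1.symm)⟩

/-! ### The real arithmetic -/

/-- **Real-arithmetic core**: from the six BHK bounds `A₁₂ m₁₂ ≤ P₁₂ T₁₂`, `P₁₂ U₁₂ ≤ A₁₂ m₃`,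
`A₁ m₁ ≤ P₁ T₁`, `P₁ U₁ ≤ A₁ m₂₃`, `A₂ m₂ ≤ P₂ T₂`, `P₂ U₂ ≤ A₂ m₁₃`, nonnegativity of the `P`'s
and `X = (T₁₂ − U₁₂) + (T₁ − U₁) + (T₂ − U₂)`:
`P₁ P₂ A₁₂ (m₁₂ − m₃) + P₁₂ P₂ A₁ (m₁ − m₂₃) + P₁₂ P₁ A₂ (m₂ − m₁₃) ≤ P₁₂ P₁ P₂ X`.
[cite: KozmaNitzan2024, Theorem 2, proof (p. 9, "P₁₂ I ≥ A₁₂(m₁₂ − m₃)" and its two analogues)] -/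
theorem knBad_arith {T₁₂ U₁₂ T₁ U₁ T₂ U₂ P₁₂ P₁ P₂ A₁₂ A₁ A₂ m₁₂ m₃ m₁ m₂₃ m₂ m₁₃ X : ℝ}
    (hP₁₂ : 0 ≤ P₁₂) (hP₁ : 0 ≤ P₁) (hP₂ : 0 ≤ P₂)
    (hX : X = (T₁₂ - U₁₂) + (T₁ - U₁) + (T₂ - U₂))
    (h1 : A₁₂ * m₁₂ ≤ P₁₂ * T₁₂) (h2 : P₁₂ * U₁₂ ≤ A₁₂ * m₃)
    (h3 : A₁ * m₁ ≤ P₁ * T₁) (h4 : P₁ * U₁ ≤ A₁ * m₂₃)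
    (h5 : A₂ * m₂ ≤ P₂ * T₂) (h6 : P₂ * U₂ ≤ A₂ * m₁₃) :
    P₁ * P₂ * A₁₂ * (m₁₂ - m₃) + P₁₂ * P₂ * A₁ * (m₁ - m₂₃) + P₁₂ * P₁ * A₂ * (m₂ - m₁₃) ≤
      P₁₂ * P₁ * P₂ * X := by
  have ha : A₁₂ * (m₁₂ - m₃) ≤ P₁₂ * (T₁₂ - U₁₂) := by linarith
  have hb : A₁ * (m₁ - m₂₃) ≤ P₁ * (T₁ - U₁) := by linarith
  have hc : A₂ * (m₂ - m₁₃) ≤ P₂ * (T₂ - U₂) := by linarith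
  have i1 : P₁ * P₂ * (A₁₂ * (m₁₂ - m₃)) ≤ P₁ * P₂ * (P₁₂ * (T₁₂ - U₁₂)) :=
    mul_le_mul_of_nonneg_left ha (mul_nonneg hP₁ hP₂)
  have i2 : P₁₂ * P₂ * (A₁ * (m₁ - m₂₃)) ≤ P₁₂ * P₂ * (P₁ * (T₁ - U₁)) :=
    mul_le_mul_of_nonneg_left hb (mul_nonneg hP₁₂ hP₂)
  have i3 : P₁₂ * P₁ * (A₂ * (m₂ - m₁₃)) ≤ P₁₂ * P₁ * (P₂ * (T₂ - U₂)) :=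
    mul_le_mul_of_nonneg_left hc (mul_nonneg hP₁₂ hP₁)
  rw [hX]
  linarith

/-! ### Assembly -/

/-- **Kozma–Nitzan arXiv:2401.12397, proof of Theorem 2 (§3.2, pp. 8–9): the six set-BHK bounds,
unconditional and denominator-free** — exactly the registered stub `stub_knBadBound` of the line
`replica-splice-at-entrance`.  With `X := μ(oA ∩ ob) − μ(oA ∩ a₃b)` (`oA = oa₁ ∪ oa₂ ∪ oa₃`),
`P₁₂ = μ(N₁₂)`, `P₁ = μ(N₁)`, `P₂ = μ(N₂)`, `A₁₂ = μ(N₁₂ ∩ (a₁o ∪ a₂o))`, `A₁ = μ(N₁ ∩ a₁o)`,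
`A₂ = μ(N₂ ∩ a₂o)` and the patterns `m_T = μ(𝒞(b) ∩ A = T)`:
`P₁ P₂ A₁₂ (m₁₂ − m₃) + P₁₂ P₂ A₁ (m₁ − m₂₃) + P₁₂ P₁ A₂ (m₂ − m₁₃) ≤ P₁₂ P₁ P₂ X`
(from `P₁₂ I ≥ A₁₂ (m₁₂ − m₃)`, `P₁ II ≥ A₁ (m₁ − m₂₃)`, `P₂ III ≥ A₂ (m₂ − m₁₃)`, each the
difference of a one-cluster lower bound (BHK Thm. 1.3 for a vertex set) and a two-cluster upper
bound (BHK Thm. 1.4), multiplied by the other two nonnegative `P`'s, and `X = I + II + III`).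
Only the distinctness of the relays is used. [cite: KozmaNitzan2024, Theorem 2, proof (pp. 8–9)] -/
theorem stub_knBadBound :
    ∀ (n : ℕ) (w : Sym2 (Fin n) → unitInterval) (o b a₁ a₂ a₃ : Fin n), a₁ ≠ a₂ → a₁ ≠ a₃ → a₂ ≠ a₃ → b ≠ a₁ → b ≠ a₂ → b ≠ a₃ →
      (prodBernoulli w).real ((openConn a₁ a₂)ᶜ ∩ (openConn a₁ a₃)ᶜ) * (prodBernoulli w).real ((openConn a₂ a₁)ᶜ ∩ (openConn a₂ a₃)ᶜ) * (prodBernoulli w).real ((openConn a₁ a₃)ᶜ ∩ (openConn a₂ a₃)ᶜ ∩ (openConn a₁ o ∪ openConn a₂ o)) * ((prodBernoulli w).real (openConn b a₁ ∩ openConn b a₂ ∩ (openConn b a₃)ᶜ) - (prodBernoulli w).real (openConn b a₃ ∩ (openConn b a₁)ᶜ ∩ (openConn b a₂)ᶜ)) + (prodBernoulli w).real ((openConn a₁ a₃)ᶜ ∩ (openConn a₂ a₃)ᶜ) * (prodBernoulli w).real ((openConn a₂ a₁)ᶜ ∩ (openConn a₂ a₃)ᶜ) * (prodBernoulli w).real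 ((openConn a₁ a₂)ᶜ ∩ (openConn a₁ a₃)ᶜ ∩ openConn a₁ o) * ((prodBernoulli w).real (openConn b a₁ ∩ (openConn b a₂)ᶜ ∩ (openConn b a₃)ᶜ) - (prodBernoulli w).real (openConn b a₂ ∩ openConn b a₃ ∩ (openConn b a₁)ᶜ)) + (prodBernoulli w).real ((openConn a₁ a₃)ᶜ ∩ (openConn a₂ a₃)ᶜ) * (prodBernoulli w).real ((openConn a₁ a₂)ᶜ ∩ (openConn a₁ a₃)ᶜ) * (prodBernoulli w).real ((openConn a₂ a₁)ᶜ ∩ (openConn a₂ a₃)ᶜ ∩ openConn a₂ o) * ((prodBernoulli w).real (openConn b a₂ ∩ (openConn b a₁)ᶜ ∩ (openConn b a₃)ᶜ) - (prodBernoulli w).real (openConn b a₁ ∩ openConn b a₃ ∩ (openConn b a₂)ᶜ)) ≤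
        (prodBernoulli w).real ((openConn a₁ a₃)ᶜ ∩ (openConn a₂ a₃)ᶜ) * (prodBernoulli w).real ((openConn a₁ a₂)ᶜ ∩ (openConn a₁ a₃)ᶜ) * (prodBernoulli w).real ((openConn a₂ a₁)ᶜ ∩ (openConn a₂ a₃)ᶜ) * ((prodBernoulli w).real ((openConn o a₁ ∪ openConn o a₂ ∪ openConn o a₃) ∩ openConn o b) - (prodBernoulli w).real ((openConn o a₁ ∪ openConn o a₂ ∪ openConn o a₃) ∩ openConn a₃ b)) := by
  intro n w o b a₁ a₂ a₃ h12 h13 h23 _hb1 _hb2 _hb3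
  -- the six set-BHK bounds (KN p. 9), instantiated exactly as in `knThm2_core`
  have i1 := knThm2_bhkOne stub_bhkSets.1 w {a₁, a₂} ({a₃} : Set (Fin n)) o b
    (by simp [h13, h23])
  have i2 := knThm2_bhkTwo stub_bhkSets.2 w {a₁, a₂} {a₃} o b (by simp [h13.symm, h23.symm])
  have i3 := knThm2_bhkOne stub_bhkSets.1 w {a₁} ({a₂, a₃} : Set (Fin n)) o b
    (by simp [h12, h13])
  have i4 := knThm2_bhkTwo stub_bhkSets.2 w {a₁} {a₂, a₃} o b (by simp [h12, h13])
  have i5 := knThm2_bhkOne stub_bhkSets.1 w {a₂} ({a₁, a₃} : Set (Fin n)) o b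
    (by simp [h12.symm, h23])
  have i6 := knThm2_bhkTwo stub_bhkSets.2 w {a₂} {a₁, a₃} o b (by simp [h12.symm, h23])
  rw [knThm2_sep_pair_set, Finset.set_biUnion_insert, Finset.set_biUnion_singleton,
    Finset.set_biInter_insert, Finset.set_biInter_singleton] at i1
  rw [knThm2_sep_pair_finset, Finset.set_biUnion_insert, Finset.set_biUnion_singleton,
    Finset.set_biInter_singleton] at i2
  rw [knThm2_sep_single_set, Finset.set_biUnion_singleton, Finset.set_biInter_singleton] at i3
  rw [knThm2_sep_single_finset, Finset.set_biUnion_singleton, Finset.set_biInter_insert,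
    Finset.set_biInter_singleton] at i4
  rw [knThm2_sep_single_set, Finset.set_biUnion_singleton, Finset.set_biInter_singleton] at i5
  rw [knThm2_sep_single_finset, Finset.set_biUnion_singleton, Finset.set_biInter_insert,
    Finset.set_biInter_singleton] at i6
  -- the patterns of `𝒞(b) ∩ A`, written on the separation events
  rw [knThm2_m12 b a₁ a₂ a₃, knThm2_m3 b a₁ a₂ a₃, knBad_m1 b a₁ a₂ a₃, knBad_m23 b a₁ a₂ a₃,
    knBad_m2 b a₁ a₂ a₃, knBad_m13 b a₁ a₂ a₃]
  -- `X = I + II + III` and the arithmetic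
  have hX := stub_knThm2GoodSplit n w o b a₁ a₂ a₃
  exact knBad_arith measureReal_nonneg measureReal_nonneg measureReal_nonneg hX i1 i2 i3 i4 i5 i6

end

end Summit.CriticalPhenomena.PercolationContinuityZ3.Theorems
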